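import Literature.AlgebraicGeometry.Morphisms.NagataCompactificationProofs
import Literature.AlgebraicGeometry.Resolution.DivisorialPart
import Literature.AlgebraicGeometry.Resolution.BlowupDisjointCentreSplitting
import Literature.AlgebraicGeometry.Resolution.BlowupsProduct
import Literature.AlgebraicGeometry.Resolution.AlterationsMultisectionLocalStep
import Literature.AlgebraicGeometry.CossartPiltant200819.Thm11ProjectiveIntegral2019
import Literature.Topology.KrullDimZero
import HarnessLib

/-!
# A proper birational morphism from a regular scheme is dominated by a blowing up along an ideal
# of codimension `≥ 2` (Stacks 080E/081T + the divisorial part of an ideal sheaf)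

Topic: `Literature/AlgebraicGeometry/Resolution`. PROVED, fact-free, definition-free. Step S2 (with S1
packaged) of the F-53 route (δ) «domination + divisorial twist» of the D-0154 (2) RES inputs cell
(seats res-inputs-p-9b / res-inputs-p-9c): the geometric input of a fact-free proof of the W4.4 door
instance `NoZeno.GWH2ResolutionDim2` (Čech `H² = 0` on a resolution of a two-dimensional local domain)
that avoids both Görtz–Wedhorn II Cor. 24.44 (formal functions) and Lipman's (27.2) (projectivity of
resolutions).

THE MATHEMATICS. Let `π : X → S` be proper, `S` quasi-compact quasi-separated, and an isomorphism over
a quasi-compact open `U ⊆ S` with `π⁻¹U ≠ ∅`. By Stacks 081T with 080E (tree, unconditional: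
`Morphisms.exists_isBlowup_dominating`) there are a `U`-admissible blowing up `b : S′ → S` along an ideal
`𝓘` with `V(𝓘) = S ∖ U` and a morphism `r : S′ → X` with `r ≫ π = b` which is the blowing up of `X`
along `K := 𝓘·𝒪_X`. If `X` is REGULAR, integral and Noetherian, `K = H · J` with `H` an effective
Cartier divisor and `V(J)` of codimension `≥ 2` (Cossart–Piltant 2008, proof of Prop. 4.2; tree
`exists_divisorial_decomposition`, Auslander–Buchsbaum behind it), and **a blowing up along `H · J`
with `H` invertible IS a blowing up along `J`** (`IsBlowup.of_mul_isEffectiveCartier_left`: split it as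
`Bl_J` followed by the blowing up of the pull-back of `H`, Stacks 080A = tree
`IsBlowup.exists_comp_eq_of_mul'`; the pull-back is again effective Cartier, Stacks 0809 = tree
`IsEffectiveCartier.comap_of_isBlowup`, so the second step is an isomorphism, `IsBlowup.isIso`). Hence
`r` is an isomorphism over `X ∖ V(J)` (`IsBlowup.isIso_morphismRestrict`), and when `dim X ≤ 2` the
locus `V(J)` — all of whose points have codimension `≥ 2` — is a FINITE set of CLOSED points. Over an
affine Noetherian base `S = Spec A`, `S′` is projective over `A` (`IsBlowup.isProjectiveOverRing_of_isAffine`).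

* `IsBlowup.of_mul_isEffectiveCartier_left` / `_right` — blowing up `H · J` (`J · H`) with `H` effective
  Cartier is blowing up `J`;
* (private plumbing) `finite_and_isClosed_singleton_of_le_coheight` — in a Noetherian scheme of
  dimension `≤ n`, a closed set all of whose points have codimension `≥ n` is a finite set of closed
  points (`topologicalKrullDim_le_of_forall_height_le`, `set_finite_of_topologicalKrullDim_le_zero`);
* `exists_isBlowup_dominating_codimTwo` — the package `(𝓘, S′, b, r, J)` above for `π : X → S` proper,
  `X` regular integral Noetherian, iso over `U` with `π⁻¹U ≠ ∅`: `IsBlowup b 𝓘`, `V(𝓘) = S ∖ U`,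
  `r ≫ π = b`, `IsBlowup r J`, `𝓘·𝒪_X ≤ J`, `V(J) ⊆ X ∖ π⁻¹U`, `V(J)` of codimension `≥ 2`;
* `exists_isBlowup_dominating_codimTwo_finite` — the same with `dim X ≤ 2`: `V(J)` finite, its points
  closed, and `r` an isomorphism over `X ∖ V(J)`;
* `IsResolution.exists_isBlowup_dominating_codimTwo` — the reading for a resolution `π : X → Spec A` of a
  Noetherian ring `A` with `dim X ≤ 2` (`X` integral Noetherian): moreover `S′` is projective over `A`
  (`Crystalline.IsProjectiveOverRing`).

What is NOT here: any cohomology (steps S3–S7 of the route: Čech transfer along `r`, Serre vanishing for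
the twists on the pieces `r⁻¹U_k = Bl_{J(U_k)} ↪ 𝐏^m`, assembly); `dim X ≤ 2` for a resolution of a
two-dimensional domain is taken as a hypothesis. No summit statement is proved; `GortzWedhorn2023_24_44_H2`
(general) stays PRINT. AI-written; AI review is weaker than expert review.

## References
* The Stacks Project, Tags 080E, 081T (dominating a proper morphism by a `U`-admissible blowing up),
  080A (blowing up a product of ideals), 0809 (effective Cartier divisors pull back along blowing ups),
  02ND. [StacksProject]
* V. Cossart, O. Piltant, J. Algebra 320 (2008), proof of Prop. 4.2 (`I = H · J`, `V(J)` of codimension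
  at least two). [CossartPiltant2008]
* U. Görtz, T. Wedhorn, *Algebraic Geometry I*, 2nd ed. (2020), Prop. 13.91 (3), (13.19), Prop. 13.96.
  [GortzWedhorn2020]
* Q. Liu, *Algebraic Geometry and Arithmetic Curves* (2002), Prop. 8.1.12 (b). [Liu2002]
-/

noncomputable section

open CategoryTheory CategoryTheory.Limits AlgebraicGeometry TopologicalSpace IsLocalRing

namespace Literature.AlgebraicGeometry.Resolution

universe u

open Scheme.IdealSheafData

/-! ## Blowing up `H · J` with `H` invertible is blowing up `J` -/

section Product

variable {X X' : Scheme.{u}} {τ : X' ⟶ X} {H J : X.IdealSheafData}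

/-- **A blowing up along `H · J` with `H` an effective Cartier divisor is a blowing up along `J`.**
Split `τ = τ₂ ≫ τ₁` with `τ₁` a blowing up along `J` and `τ₂` the blowing up of the pull-back
`H 𝒪_{X₁}` (Stacks 080A); that pull-back is an effective Cartier divisor (Stacks 0809), so `τ₂` is an
isomorphism (Görtz–Wedhorn I (13.19)) and `τ` is a blowing up along `J`.
[cite: StacksProject, Tag 080A] [cite: StacksProject, Tag 0809] [cite: GortzWedhorn2020, (13.19) p. 413] -/
theorem IsBlowup.of_mul_isEffectiveCartier_left (hτ : IsBlowup τ (H * J)) (hH : IsEffectiveCartier H) :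
    IsBlowup τ J := by
  obtain ⟨X₁, τ₁, τ₂, hτ₁, hτ₂, hcomp⟩ := hτ.exists_comp_eq_of_mul'
  haveI : IsIso τ₂ := hτ₂.isIso (hH.comap_of_isBlowup hτ₁)
  rw [← hcomp]
  exact hτ₁.iso_comp (asIso τ₂)

/-- The same with the factors written `J · H`. [cite: StacksProject, Tag 080A] -/
theorem IsBlowup.of_mul_isEffectiveCartier_right (hτ : IsBlowup τ (J * H)) (hH : IsEffectiveCartier H) :
    IsBlowup τ J := by
  rw [mul_comm] at hτ
  exact hτ.of_mul_isEffectiveCartier_left hH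

end Product

/-! ## A closed set of points of codimension `≥ dim X` is a finite set of closed points -/

section Finite

variable {X : Scheme.{u}}

/-- **In a scheme of dimension `≤ n`, a closed subset all of whose points have codimension `≥ n` has
dimension `≤ 0`**: `height x + coheight x ≤ dim X ≤ n` and `coheight x ≥ n` force `height x = 0`, and a
closed set whose points have height `0` has dimension `≤ 0` (`topologicalKrullDim_le_of_forall_height_le`).
[folklore] -/
private theorem topologicalKrullDim_le_zero_of_le_coheight {n : ℕ} (hdim : topologicalKrullDim X ≤ n)
    {Z : Set X} (hZ : IsClosed Z) (hco : ∀ x ∈ Z, (n : ℕ∞) ≤ Order.coheight x) :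
    topologicalKrullDim Z ≤ 0 := by
  have h := topologicalKrullDim_le_of_forall_height_le hZ 0 fun x hx => by
    have h2 : Order.height x + Order.coheight x ≤ n := by
      have := (coe_height_add_coheight_le_topologicalKrullDim x).trans hdim
      exact_mod_cast this
    have hc : Order.coheight x ≤ n := le_trans le_add_self h2
    obtain ⟨c, hc'⟩ := ENat.ne_top_iff_exists.mp (ne_top_of_le_ne_top (ENat.coe_ne_top n) hc)
    have hh : Order.height x ≠ ⊤ := by
      intro h
      rw [h, top_add, top_le_iff] at h2
      exact ENat.coe_ne_top n h2
    obtain ⟨a, ha'⟩ := ENat.ne_top_iff_exists.mp hh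
    have h1 : (n : ℕ∞) ≤ Order.coheight x := hco x hx
    rw [← hc', ← ha'] at h2
    rw [← hc'] at h1
    rw [← ha']
    have h1' : n ≤ c := by exact_mod_cast h1
    have h2' : a + c ≤ n := by exact_mod_cast h2
    exact_mod_cast (show a ≤ 0 by omega)
  exact_mod_cast h

/-- **In a Noetherian scheme of dimension `≤ n`, a closed subset all of whose points have codimension
`≥ n` is a finite set of closed points.** [folklore] -/
private theorem finite_and_isClosed_singleton_of_le_coheight [NoetherianSpace X] {n : ℕ}
    (hdim : topologicalKrullDim X ≤ n) {Z : Set X} (hZ : IsClosed Z)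
    (hco : ∀ x ∈ Z, (n : ℕ∞) ≤ Order.coheight x) :
    Z.Finite ∧ ∀ x ∈ Z, IsClosed ({x} : Set X) := by
  have h0 := topologicalKrullDim_le_zero_of_le_coheight hdim hZ hco
  exact ⟨set_finite_of_topologicalKrullDim_le_zero Z h0,
    fun x hx => Literature.Topology.Set.isClosed_singleton_of_topologicalKrullDim_le_zero hZ h0 hx⟩

/-- In particular **in a Noetherian scheme of dimension `≤ 2` a closed subset of points of codimension
`> 1` is a finite set of closed points** (the shape `1 < coheight x` of `DivisorialPart.lean`).
[folklore] -/
private theorem finite_and_isClosed_singleton_of_one_lt_coheight [NoetherianSpace X]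
    (hdim : topologicalKrullDim X ≤ 2) {Z : Set X} (hZ : IsClosed Z)
    (hco : ∀ x ∈ Z, 1 < Order.coheight x) :
    Z.Finite ∧ ∀ x ∈ Z, IsClosed ({x} : Set X) :=
  finite_and_isClosed_singleton_of_le_coheight hdim hZ fun x hx =>
    Order.add_one_le_of_lt (hco x hx)

end Finite

/-! ## Domination by a blowing up along an ideal of codimension `≥ 2` -/

section Domination

variable {X S : Scheme.{u}} (π : X ⟶ S)

/-- **A proper morphism from a regular scheme, an isomorphism over `U`, is dominated by a blowing up
along an ideal of codimension `≥ 2`.** `π : X → S` proper, `S` quasi-compact and quasi-separated, `X`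
regular integral Noetherian, `U ⊆ S` open (quasi-compact) with `π` an isomorphism over `U` and
`π⁻¹U ≠ ∅`. Then there are an ideal sheaf `𝓘` on `S` with `V(𝓘) = S ∖ U`, a blowing up `b : S′ → S`
along `𝓘`, a morphism `r : S′ → X` with `r ≫ π = b`, and an ideal sheaf `J` on `X` containing
`𝓘·𝒪_X`, with `V(J) ⊆ X ∖ π⁻¹U` of codimension `≥ 2`, such that `r` is a blowing up of `X` ALONG `J`
(Stacks 081T/080E for `r` as the blowing up along `𝓘·𝒪_X`; `𝓘·𝒪_X = H · J`, `H` effective Cartier,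
Cossart–Piltant's divisorial part; `IsBlowup.of_mul_isEffectiveCartier_left`).
[cite: StacksProject, Tag 081T] [cite: StacksProject, Tag 080E]
[cite: CossartPiltant2008, proof of Prop. 4.2] -/
theorem exists_isBlowup_dominating_codimTwo [CompactSpace S] [QuasiSeparatedSpace S] [IsProper π]
    [IsIntegral X] [IsNoetherian X] (hX : Scheme.IsRegular X) (U : S.Opens)
    (hU : IsCompact (U : Set S)) [IsIso (π ∣_ U)] (hne : ((π ⁻¹ᵁ U : X.Opens) : Set X).Nonempty) :
    ∃ (I : S.IdealSheafData) (S' : Scheme.{u}) (b : S' ⟶ S) (r : S' ⟶ X) (J : X.IdealSheafData),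
      IsBlowup b I ∧ (I.support : Set S) = (U : Set S)ᶜ ∧ r ≫ π = b ∧ IsBlowup r J ∧
      I.comap π ≤ J ∧ (J.support : Set X) ⊆ ((π ⁻¹ᵁ U : X.Opens) : Set X)ᶜ ∧
      ∀ x ∈ J.support, 1 < Order.coheight x := by
  obtain ⟨I, S', b, r, -, hsupp, hb, hcomp, hr⟩ :=
    Literature.AlgebraicGeometry.Morphisms.exists_isBlowup_dominating π U hU
  -- `K := 𝓘·𝒪_X` has support `X ∖ π⁻¹U`, so it is non-zero
  have hKsupp : ((I.comap π).support : Set X) = ((π ⁻¹ᵁ U : X.Opens) : Set X)ᶜ := by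
    rw [support_comap, Closeds.coe_preimage, hsupp, Set.preimage_compl]
    rfl
  have hK : I.comap π ≠ ⊥ := by
    intro h
    obtain ⟨x, hx⟩ := hne
    have hx' : x ∈ ((I.comap π).support : Set X) := by rw [h, support_bot]; trivial
    rw [hKsupp] at hx'
    exact hx' hx
  -- the divisorial decomposition `K = H · J`
  obtain ⟨H, J, hH, hHJ, hKJ, -, hcodim⟩ := exists_divisorial_decomposition hX hK
  refine ⟨I, S', b, r, J, hb, hsupp, hcomp, ?_, hKJ, ?_, hcodim⟩
  · rw [← hHJ] at hr
    exact hr.of_mul_isEffectiveCartier_left hH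
  · rw [← hKsupp]
    exact support_antitone hKJ

/-- **The same when `dim X ≤ 2`: the centre `V(J)` is a finite set of closed points and `r` is an
isomorphism over its complement** (`IsBlowup.isIso_morphismRestrict`). This is the geometry behind the
Leray-type transfer of Čech `H²` from `X` to the projective `S′`.
[cite: StacksProject, Tag 081T] [cite: CossartPiltant2008, proof of Prop. 4.2]
[cite: GortzWedhorn2020, Prop. 13.91 (3)] -/
theorem exists_isBlowup_dominating_codimTwo_finite [CompactSpace S] [QuasiSeparatedSpace S]
    [IsProper π] [IsIntegral X] [IsNoetherian X] (hX : Scheme.IsRegular X)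
    (hdim : topologicalKrullDim X ≤ 2) (U : S.Opens) (hU : IsCompact (U : Set S)) [IsIso (π ∣_ U)]
    (hne : ((π ⁻¹ᵁ U : X.Opens) : Set X).Nonempty) :
    ∃ (I : S.IdealSheafData) (S' : Scheme.{u}) (b : S' ⟶ S) (r : S' ⟶ X) (J : X.IdealSheafData),
      IsBlowup b I ∧ (I.support : Set S) = (U : Set S)ᶜ ∧ r ≫ π = b ∧ IsBlowup r J ∧
      I.comap π ≤ J ∧ (J.support : Set X) ⊆ ((π ⁻¹ᵁ U : X.Opens) : Set X)ᶜ ∧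
      (∀ x ∈ J.support, 1 < Order.coheight x) ∧
      (J.support : Set X).Finite ∧ (∀ x ∈ J.support, IsClosed ({x} : Set X)) ∧
      IsIso (r ∣_ (⟨(J.support : Set X)ᶜ, J.support.isClosed.isOpen_compl⟩ : X.Opens)) := by
  obtain ⟨I, S', b, r, J, hb, hsupp, hcomp, hr, hKJ, hJU, hcodim⟩ :=
    exists_isBlowup_dominating_codimTwo π hX U hU hne
  obtain ⟨hfin, hcl⟩ := finite_and_isClosed_singleton_of_one_lt_coheight hdim J.support.isClosed hcodim
  exact ⟨I, S', b, r, J, hb, hsupp, hcomp, hr, hKJ, hJU, hcodim, hfin, hcl,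
    hr.isIso_morphismRestrict disjoint_compl_left⟩

end Domination

/-! ## The reading for a resolution of the spectrum of a Noetherian ring -/

section Resolution

open Literature.AlgebraicGeometry.Motives Literature.AlgebraicGeometry.Crystalline

/-- **A resolution `π : X → Spec A` with `dim X ≤ 2` is dominated by a projective blowing up of
`Spec A` which is a blowing up of `X` at finitely many closed points' worth of codimension-`2` ideal.**
For `A` Noetherian, `X` integral Noetherian of dimension `≤ 2` and `π` a resolution (proper, birational,
`X` regular): there are `𝓘, S′, b : S′ → Spec A, r : S′ → X, J` with `b` a blowing up along `𝓘` — so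
`S′` is PROJECTIVE over `A` (`IsBlowup.isProjectiveOverRing_of_isAffine`) — `r ≫ π = b`, `r` a blowing up
of `X` along `J`, `V(J)` a finite set of closed points of codimension `≥ 2`, and `r` an isomorphism over
`X ∖ V(J)`. (For a resolution of a two-dimensional Noetherian local domain `dim X ≤ 2` holds; it is kept
as a hypothesis here.) [cite: StacksProject, Tag 081T] [cite: CossartPiltant2008, proof of Prop. 4.2]
[cite: Liu2002, Prop. 8.1.12 (b)] -/
theorem IsResolution.exists_isBlowup_dominating_codimTwo {A : Type u} [CommRing A] [IsNoetherianRing A]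
    {X : Scheme.{u}} [IsIntegral X] [IsNoetherian X] {π : X ⟶ Spec (.of A)} (hπ : IsResolution π)
    (hdim : topologicalKrullDim X ≤ 2) :
    ∃ (I : (Spec (.of A)).IdealSheafData) (S' : Scheme.{u}) (b : S' ⟶ Spec (.of A)) (r : S' ⟶ X)
      (J : X.IdealSheafData),
      IsBlowup b I ∧ IsProjectiveOverRing (Over.mk b : SchemeOver A) ∧ r ≫ π = b ∧ IsBlowup r J ∧
      (∀ x ∈ J.support, 1 < Order.coheight x) ∧ (J.support : Set X).Finite ∧
      (∀ x ∈ J.support, IsClosed ({x} : Set X)) ∧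
      IsIso (r ∣_ (⟨(J.support : Set X)ᶜ, J.support.isClosed.isOpen_compl⟩ : X.Opens)) := by
  haveI : IsProper π := hπ.isProper
  obtain ⟨U, -, hUdense, hUiso⟩ := hπ.isBirational
  haveI := hUiso
  have hne : ((π ⁻¹ᵁ U : X.Opens) : Set X).Nonempty := hUdense.nonempty
  obtain ⟨I, S', b, r, J, hb, -, hcomp, hr, -, -, hcodim, hfin, hcl, hiso⟩ :=
    exists_isBlowup_dominating_codimTwo_finite π hπ.isRegular hdim U
      (NoetherianSpace.isCompact _) hne
  exact ⟨I, S', b, r, J, hb, hb.isProjectiveOverRing_of_isAffine, hcomp, hr, hcodim, hfin, hcl, hiso⟩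

end Resolution

end Literature.AlgebraicGeometry.Resolution

end
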